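import Mathlib
import HarnessLib
import HarnessLib.Audit
import Summits.AtomisticToContinuum.Statement
import Summits.AtomisticToContinuum.HydrodynamicLimit.Theorems.AntiMazurCoboundariesHomogeneousInvariance

/-!
Route: CramerEdgeLadder

CLOSED (retired) 2026-08-16T03:15:00Z by planner-rchoice-AtomisticToContinuum-CramerEdg-c7e622b8-0 — reason: not-a-thesis: target-unreachable — no item concludes the target AmplitudeUniformLimit and no honest glue exists: the moderate-deviation engine reaches only the δ_N→0 members; any Crux…→top chain needs a macroscopic-amplitude item that eithe — note: route-choice (unit rchoice-…-CramerEdg-c7e622b8; operator hold 02:51Z route.target-unreachable on AmplitudeUniformLimit stmt-10964). CHOSEN: retire. WHY NO GLUE: the engine (exact tilt of the invariant law + cumulant method of moderate deviations) reaches only the delta_N -> 0 members of the ladder . The file is kept as the record of this route; refuted decls are indexed as negative knowledge (`ledger negatives`).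

# Route CramerEdgeLadder — amplitude ladder from the CLT edge to the conjunct — mesoscopic local
Gibbs data make hard-sphere hydrodynamics a moderate-deviation problem for the invariant gas; the
conjunct is its Cramér edge

CONFORMING SUCCESSOR (D-0027 §2.1) of route-AtomisticToContinuum-ModerateDeviationWindow (opened
12:17Z, closed `not-a-thesis` by the
13:55Z audit because its Assembly stopped at the rung `SoundWindow`): same mechanism and items,
re-filed as an AMPLITUDE LADDER whose top
CONTAINS the conjunct (precedent AlphaScalingLadder), with the sorry-free deciding theorem `closes :
AmplitudeUniformLimit → HydrodynamicLimit`.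
Card moderate-deviation-sound-window. It suffices to show X = AmplitudeUniformLimit (LADDER TOP):
for all continuous positive profiles
(a₀, u₀, θ₀), every base temperature θe > 0 and exponent a ∈ (0, 1/2) there is σ₀ > 0 such that for
σ ∈ (0, σ₀), every family
(ρ^d, u^d, θ^d), d ∈ (0,1], of classical hs-Euler solutions on [0,T), all hard-sphere flows and
EVERY amplitude sequence
(N+1)^(a-1/2) ≤ δ_N ≤ 1: under the local Gibbs laws with the power-path profiles (a₀^δ_N, δ_N u₀,
θe^(1-δ_N) θ₀^δ_N) (global equilibrium
(1, 0, θe) at δ = 0, the given datum at δ = 1), if the empirical fields match (ρ, ρu, E)^(δ_N)(0) at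
t = 0 with AMPLITUDE-RELATIVE precision
(deviation > ηδ_N has vanishing probability for every η > 0), then so do the fields at every t < T
against (ρ, ρu, E)^(δ_N)(t) — the
hydrodynamic limit UNIFORMLY IN THE DATA AMPLITUDE from O(1) down to the CLT edge. Its corner δ_N ≡
1 (constant family) is literally the
conjunct (`closes`, 8 lines: rpow_one / rpow_zero / one_smul / mul_one); its bottom members δ_N =
(N+1)^(a-1/2) are the MODERATE-DEVIATION
SOUND WINDOWS — crux SoundWindow, stated on the exact-tilt path (entropy variables (1,0,θe) +
δ_N·(α, w/θe, τ/θe): profiles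
a_δ = exp(δα + δ²|w|²/(2θe(1-δτ)))·(1-δτ)^(-3/2), u_δ = δw/(1-δτ), θ_δ = θe/(1-δτ), an EXACT
exponential tilt of the invariant canonical law;
limit = classical LINEARISED hs-Euler about (1, 0, θe): ∂tρ₁ + div u₁ = 0, ∂tu₁ + p_ρ∇ρ₁ + Z(σ³)∇θ₁
= 0, ∂tθ₁ + (2/3)p̄ div u₁ = 0, dense sound
speed c² = θe(Z + σ³Z′ + ⅔Z²); genuinely out of equilibrium: tilt entropy ≍ N^(2a) → ∞) — which THIS
route derives from its two ranked
cruxes CumulantBounds (analytic-type mixed space-time cumulant bounds of the invariant gas) and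
EulerScaleCovariance (Spohn's Euler-scale
two-point conjecture, linear matched form) by the cumulant method of large deviations (support
WindowAssembly; CumulantMdpTransfer,
TiltIdentity, HomogeneousInvariance = stmt-3073, EquilibriumIsProbability provable now). The LINE is
the ladder: climb the amplitude from the
CLT edge, where hydrodynamics of deterministic spheres is a MODERATE-deviation problem for (Φ, G)
needing only bounds + order-two
identification, to the corner δ ≡ 1, where the tilt parameter reaches the Cramér radius (θ = √N) and
the conjunct is a LARGE-deviation
statement about the same pair — the edge the whole board is stuck at, now located.
REV 2 (2026-08-15, repair of the retriage signature concern): every USED member d = δ_N of the Euler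
family is PINNED conjunct-style to the amplitude-δ_N local Gibbs data (extra hypothesis `∀ N,
TendstoHydroFieldsAt (LG^{δ_N}) Φ (ρE (δ N)) (uE (δ N)) (θE (δ N)) 0`, full sequence M → ∞, fixed
precision), so the family is no longer free across d; at the corner the pin is the conjunct's own
hypothesis.
Lean: `open Literature.MathematicalPhysics.KineticTheory Literature.Analysis.FluidPDE MeasureTheory
Filter Topology in ∀ (a₀ θ₀ : T3 → ℝ) (u₀ : T3 → V3), Continuous a₀ → Continuous θ₀ → Continuous u₀
→ (∀ x, 0 < a₀ x) → (∀ x, 0 < θ₀ x) → ∀ θe : ℝ, 0 < θe → ∀ a : ℝ, 0 < a → a < 1 / 2 → ∃ σ₀ : ℝ, 0 <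
σ₀ ∧ ∀ σ : ℝ, 0 < σ → σ < σ₀ → ∀ (T : ℝ) (ρE θE : ℝ → ℝ → T3 → ℝ) (uE : ℝ → ℝ → T3 → V3), (∀ d ∈
Set.Ioc (0 : ℝ) 1, IsHardSphereEulerSolution σ T (ρE d) (uE d) (θE d)) → ∀ Φ : (N : ℕ) →
HardSphereFlow (Torus.geometry (Fin 3)) (hsDiameter σ N) (N + 1), ∀ δ : ℕ → ℝ, (∀ N : ℕ, ((N : ℝ) +
1) ^ (a - 1 / 2) ≤ δ N ∧ δ N ≤ 1) → (∀ N : ℕ, TendstoHydroFieldsAt (fun M => localGibbsLaw σ (fun x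
=> a₀ x ^ δ N) (fun x => δ N • u₀ x) (fun x => θe ^ (1 - δ N) * θ₀ x ^ δ N) M (Φ M)) Φ (ρE (δ N))
(uE (δ N)) (θE (δ N)) 0) → let P : (N : ℕ) → Measure (Config (N + 1) (Fin 3) T3) := fun N =>
localGibbsLaw σ (fun x => a₀ x ^ δ N) (fun x => δ N • u₀ x) (fun x => θe ^ (1 - δ N) * θ₀ x ^ δ N) N
(Φ N); let R : ℝ → Prop := fun t => ∀ χ : T3 → ℝ, Continuous χ → ∀ η : ℝ, 0 < η → Tendsto (fun N =>
P N {z | η * δ N < |empiricalDensityField ((Φ N).flow t z) χ - ∫ x, χ x * ρE (δ N) t x|}) atTop (𝓝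
0) ∧ Tendsto (fun N => P N {z | η * δ N < ‖empiricalMomentumField ((Φ N).flow t z) χ - ∫ x, (χ x *
ρE (δ N) t x) • uE (δ N) t x‖}) atTop (𝓝 0) ∧ Tendsto (fun N => P N {z | η * δ N <
|empiricalEnergyField ((Φ N).flow t z) χ - ∫ x, χ x * totalEnergyDensity (ρE (δ N) t x) (uE (δ N) t
x) (θE (δ N) t x)|}) atTop (𝓝 0); R 0 → ∀ t ∈ Set.Ico 0 T, R t`

## Assembly
DECIDING THEOREM (D-0027 §2.1, glue.lean, lean check rc 0, axioms propext / Classical.choice /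
Quot.sound):
`theorem closes : AmplitudeUniformLimit → HydrodynamicLimit` — given profiles, take θe := 1, a :=
1/4, σ₀ from the ladder top; for σ < σ₀,
a classical solution (ρ, u, θ) on [0,T), flows Φ and LLN data at t = 0, instantiate the top with the
CONSTANT family d ↦ (ρ, u, θ) and the
constant amplitude sequence δ_N ≡ 1 (admissible: (N+1)^(-1/4) ≤ 1 ≤ 1,
Real.rpow_le_one_of_one_le_of_nonpos); `simp only [Real.rpow_one,
one_smul, sub_self, Real.rpow_zero, one_mul, mul_one]` turns the power-path law into localGibbsLaw σ
a₀ u₀ θ₀ and the thresholds η·1 into η,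
after which hypothesis and conclusion are literally TendstoHydroFieldsAt at 0 and at t (the pin
hypothesis is discharged by `fun _ => h0`; last line `exact key (fun _ => h0) h0 t ht`). The rung's
own glue is the support WindowAssembly
(bookkeeping described there); ThirdCumulantBound is not used by either (k = 3 special case of
CumulantBounds, staffed for information).

Rationale: WHY THIS LINE. Mechanism (Spohn1991 Part II §7.1 pp. 88–89 read: (7.16) rewrites the Euler-scale
equilibrium covariance as the λ-derivative at λ = 0 of a
local-equilibrium expectation with tilt exp[λ∫φ n], then takes ε → 0 BEFORE ∂_λ, without proof; this
route takes the JOINT limit along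
λ = λ_N = N^(a-1/2)): because the local Gibbs log-density is linear in the conserved one-body fields
and the canonical law G_N is flow-invariant,
the time-t law of a CLT-scaled field statistic X̃_t under LG_N is EXACTLY the exponential tilt, at
the moderate parameter θ_N = δ_N√(N+1) =
(N+1)^a, of the joint EQUILIBRIUM law of (X̃_t, Ỹ_0); the cumulant method of large deviations
(SaulisStatulevicius1991; MDP form
DoringEichelsbacher2012) then needs only analytic-type BOUNDS |N^(k-1)κ_k| ≤ C^k k! on mixed
two-time equilibrium cumulants (CumulantBounds) and
IDENTIFICATION AT ORDER TWO (EulerScaleCovariance = Spohn1991 (7.18)–(7.19), Landau–Placzek with the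
hard-sphere equation of state) to give the
law of large numbers at scale δ_N with the linear-response limit (CumulantMdpTransfer: the tilted
cgf is a convergent cumulant series for
|ζ| < N·min(s₀, 1/2C), exponential Chebyshev at speed N^(2a), error δ_N → 0 — verified by hand, half
a page). Imported areas: limit theorems
of large deviations via cumulants (Lithuanian school) and the moderate-deviation genre for
hydrodynamic limits of STOCHASTIC dynamics (Gao2003
SSEP, GaoXia2026 binary collision model; static Gibbs fields Scola2021), transplanted to a
deterministic gas where the exact tilt identity
replaces martingale / super-exponential tools; Euler-scale correlation physics from Spohn1991,
Doyon2022, DoyonEtAl2023 (BMFT: what the bounded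
cumulants should converge to — NOT needed). Versus the board: AmplitudeAnalyticity (5609–5611) needs
complex zero-freeness along the whole
amplitude segment [0,1] plus all-order identification and proves the conjunct; this line stays at
real mesoscopic amplitudes, needs bounds at
zero tilt only and identification at order two, and proves a weaker N-indexed family whose boundary
a = 1/2 (θ = √N = Cramér radius) IS the
conjunct; BurgersWindow (5861–5865) takes δ_N-data to times 1/δ_N (nonlinear Burgers);
EquilibriumLinearResponse (stmt-3075, LaceRingBootstrap
crux / OneParticleInfluence support) and MourreKoopman's OneBodyCompleteness (4356) are the κ = 0
linear statement in other frames — this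
route is its non-equilibrium amplifier and files the first typed cumulant-level (k ≥ 3) cruxes of
the sub-problem; the ladder top adds the natural uniformity-in-amplitude strengthening whose bottom
is provable-in-principle by this mechanism and whose top is the conjunct. Negatives index empty.

RANKED CRUXES. #0 AmplitudeUniformLimit (target; rev 2 PINNED) — LADDER TOP — the hydrodynamic limit
uniform in the data amplitude (§ Thesis): power-path local Gibbs data (a₀^δ_N, δ_N u₀,
θe^(1-δ_N)θ₀^δ_N), any (N+1)^(a-1/2) ≤ δ_N ≤ 1, a d-indexed family of classical solutions whose
every used member d = δ_N is pinned conjunct-style (TendstoHydroFieldsAt at t = 0, M → ∞) to the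
amplitude-δ_N data, amplitude-relative matching at t = 0 ⇒ amplitude-relative convergence in
probability at every t < T. Corner δ_N ≡ 1 = the conjunct (theorem closes, pin = h0); bottom members
= the sound windows (crux SoundWindow, up to PDE linearisation and path comparison, § Not decomposed
yet). (why it might fail: contains the conjunct and every mesoscopic window; beyond both it asserts
UNIFORMITY in the amplitude with relative precision ηδ_N — an intermediate-amplitude slow mode or
amplitude-dependent loss of precision refutes it even if each fixed-δ limit holds.) [Spohn1991,
OllaVaradhanYau1993, DoringEichelsbacher2012, DoyonEtAl2023, Kato1975]
#2 CumulantBounds (crux) — (card crux 1, analytic type γ = 0) ANALYTIC-TYPE EQUILIBRIUM SPACE-TIME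
CUMULANT BOUNDS: for θe > 0 and continuous directions (α, w, τ) there is σ₀ such that for σ < σ₀,
all flows, t ≥ 0 and continuous test functions (χ₀, χv, χ₄): with G_N the canonical law
localGibbsLaw σ 1 0 θe, X = [n(χ₀) + p(χv) + e(χ₄)]∘Φ_t the conserved-type linear field statistic at
time t and Y = n(α) + p(w/θe) + e(τ/θe) the tilt statistic at time 0, there are C, s₀ > 0 with (i)
E_G exp(s(N+1)(uX + bY)) < ∞ for |s| ≤ s₀, |u|,|b| ≤ 1 (uniform exponential moments — statics) and
(ii) |κ_k^G(uX + bY)|·(N+1)^(k-1) ≤ C^k k! for all k ≥ 2, N, |u|,|b| ≤ 1 (κ_k = k-th derivative at 0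
of the Mathlib cgf). Pure (single-time) cumulants are static by invariance; the content is the
N^(1-k) decay of MIXED two-time cumulants, i.e. an N-uniform real-analyticity radius of the finite-N
LD pressure of (X_t, Y_0) at the origin. [difficulty: open-problem] (why it might fail: Mixed
two-time cumulants must decay like N^(1-k) with k!C^k constants over ~N^(1/3) collision times at
FIXED σ: a zero-tilt dynamical phase transition (non-analytic finite-N LD pressure of (X_t,Y_0)) or
super-factorial k-growth from recollisions/long-time tails breaks it; no technique exists.)
[Spohn1991, SaulisStatulevicius1991, BodineauGallagherSaintRaymondSimonellaAHP2023, BGSSCPAM2023,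
DoyonEtAl2023, Scola2021]
#3 EulerScaleCovariance (crux) — (card crux 2 = Spohn's Euler-scale two-point conjecture
(7.18)–(7.19), LINEAR MATCHED FORM) for θe > 0 and continuous directions (α, w, τ) there is σ₀ such
that for σ < σ₀, every classical solution (ρ₁, u₁, θ₁) on [0,T) of the linearised hs-Euler system
about (1, 0, θe) and all flows: IF the static covariances match the data, (N+1)·Cov_G(Y, n_0(χ)) →
∫χρ₁(0), (N+1)·Cov_G(Y, p_0(χ)_j) → ∫χu₁,ⱼ(0), (N+1)·Cov_G(Y, e_0(χ)) → ∫χ·(3/2)(θeρ₁ + θ₁)(0) for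
all continuous χ, THEN the same holds at every t ∈ [0,T) with the time-t fields ∘Φ_t: Euler-scale
equilibrium time correlations of the conserved fields of hard spheres at fixed σ are transported by
linearised Euler (two sound modes at the dense sound speed, standing entropy/shear modes). Same
content as EquilibriumLinearResponse (stmt-3075, κ-homotopy response form) restricted to the base
point and freed of the nonlinear Euler family; the zero-excess-Drude-weight input is MourreKoopman's
OneBodyCompleteness (4356). [difficulty: open-problem] (why it might fail: It is Spohn's open
Euler-scale two-point conjecture at positive density: a hidden sixth one-body charge / positive
excess Drude weight (ballistic channel), or correlations not given by the five-mode Landau-Placzek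
projection at fixed σ, falsify it; proved for no deterministic model except hard rods.) [Spohn1991,
Doyon2022, DoyonEtAl2023, BGSSCPAM2023, BodineauGallagherSaintRaymondSimonellaAHP2023]
#4 SoundWindow (crux) — THE FIRST RUNG (card: ModerateAmplitudeHL(a), all a ∈ (0, 1/2)): for θe > 0,
continuous directions (α, w, τ) and σ < σ₀, under the exact-tilt-path local Gibbs laws at amplitude
δ_N = (N+1)^(a-1/2) the RESCALED fields ([n_t(χ) − ∫χ], p_t(χ), [e_t(χ) − (3θe/2)∫χ])/δ_N converge
in probability at every t < T to (ρ₁, u₁, (3/2)(θeρ₁ + θ₁))(t) for every classical linearised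
hs-Euler solution matched at t = 0 (conjunct-style). Derived inside the route by WindowAssembly from
cruxes #2, #3 and the provable supports; claimable directly; the MD-falsifiable member of the
ladder. [deps: CumulantBounds, EulerScaleCovariance] [difficulty: open-problem] (why it might fail:
Fails with either crux: super-CLT growth of mixed space-time cumulants (no moderate-deviation regime
for the deterministic gas) or Euler-scale correlations not transported by linearised hs-Euler; also
false if a hidden slow mode makes the δ_N-response non-linear at times O(1).) [Spohn1991,
DoringEichelsbacher2012, SaulisStatulevicius1991, DoyonEtAl2023, Gao2003]
#5 ThirdCumulantBound (crux) — (the k = 3 special case of CumulantBounds, filed as the MD-checkable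
and first provable dynamical foothold; CumulantBounds ⇒ ThirdCumulantBound) same frame: uniform
exponential moments and sup_N (N+1)²·|κ₃^G(uX + bY)| ≤ C for |u|,|b| ≤ 1 — the two-time third
cumulants (X_t, X_t, Y_0), (X_t, Y_0, Y_0) of conserved-field statistics are extensive, i.e. the
CLT-normalised third cumulant decays like (N+1)^(-1/2), uniformly at macroscopic t. [difficulty:
open-problem] (why it might fail: First dynamical cumulant: BMFT predicts a finite tree-response
limit of (N+1)^2 κ_3, but for deterministic spheres long-time tails (t^(-3/2) current correlations)
or sound-cone caustics could enhance three-point space-time correlations with N; equilibrium MD at N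
= 10^3-10^5 decides.) [DoyonEtAl2023, Spohn1991, BGSSCPAM2023]
#9 CumulantMdpTransfer (support) — ABSTRACT MODERATE-DEVIATION TRANSFER (card crux 3, γ = 0; pure
probability, no spheres): for a ∈ (0, 1/2), probability spaces (Ω_j, μ_j), sizes n_j ≥ 1 → ∞ and
measurable X_j, Y_j with uniform exponential moments E exp(s n_j(uX_j + bY_j)) < ∞ (|s| ≤ s₀,
|u|,|b| ≤ 1), analytic-type cumulant bounds |κ_k(uX_j + bY_j)| n_j^(k-1) ≤ C^k k! (k ≥ 2) and n_j
Cov(X_j, Y_j) → c: under the tilted laws μ_j.tilted(n_j^(a+1/2) Y_j) (= exp(δ_j n_j Y_j)dμ_j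
normalised, δ_j = n_j^(a-1/2)), n_j^(1/2-a)(X_j − E_μj X_j) → c in probability. Proof (verified):
the tilted cgf of λδn(X − EX) is the convergent series Σ_(k≥2)[κ_k(λX+Y) − κ_k(Y)](nδ)^k/k! inside
the radius n·min(s₀, 1/2C) (analyticAt_cgf); k = 2 term (nδ)²[λ²VarX/2 + λCov], tail ≤ 4n(Cδ)³ =
o(n^(2a)); exponential Chebyshev. [difficulty: provable-now] [DoringEichelsbacher2012,
SaulisStatulevicius1991, Gao2003]
#9 TiltIdentity (support) — THE EXACT TILT (Spohn1991 (7.16) at finite N): for d·τ < 1 pointwise and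
G_N = localGibbsLaw σ 1 0 θe N Φ a probability measure, localGibbsLaw σ a_d u_d θ_d N Φ with a_d =
exp(dα + d²|w|²/(2θe(1-dτ)))·(1-dτ)^(-3/2), u_d = (d/(1-dτ))w, θ_d = θe/(1-dτ) EQUALS
G_N.tilted(d(N+1)Y), Y = n(α) + Σ_j p(w_j/θe)_j + e(τ/θe): localGibbsProfile_d =
localGibbsProfile(1,0,θe)·exp(d(α + w·v/θe + τ|v|²/(2θe))) pointwise (checked by hand),
canonicalDensity normalises, Measure.tilted divides by Z_d/Z_0. Certifies that the rung's data ARE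
the conjunct's local Gibbs states. [difficulty: provable-now] [Spohn1991, GST2013]
#9 HomogeneousInvariance (support) — (= stmt-AtomisticToContinuum-3073 verbatim, shared with
OneParticleInfluence / HomoenergeticRung) the canonical law with constant profiles is invariant
under every hard-sphere flow, lawAt Φ p t = p (Liouville preservation + energy and momentum
conservation on the good set; rests on PROVED cone facts). Gives E_G[X_t] = E_G[X_0] = the
equilibrium values subtracted in SoundWindow. [difficulty: provable-now] [GST2013, CIP1994,
Alexander1975]
#9 EquilibriumIsProbability (support) — for 0 < σ < 1/2, θe > 0, every N and flow, localGibbsLaw σ 1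
0 θe N Φ is a probability measure: the partition function is positive (the closed hard-sphere domain
contains a neighbourhood of the cubic-lattice configuration of spacing 1/⌈(N+1)^(1/3)⌉ >
σ(N+1)^(-1/3) for σ < 1/2, times all velocities) and finite (Gaussian velocities). The probability
hypothesis of CumulantMdpTransfer / TiltIdentity. [difficulty: provable-now] [Alexander1975,
Ruelle1969]
#9 WindowAssembly (support) — THE RUNG'S GLUE (the closed route's Assembly, verified on paper): σ₀
:= min of the σ₀'s and 1/2; TiltIdentity + EquilibriumIsProbability identify the data law with the
tilted canonical law; HomogeneousInvariance gives E_G X_t = equilibrium values; static matching by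
CumulantMdpTransfer at t = 0 along subsequences + uniqueness of limits in probability;
EulerScaleCovariance transports the covariances; CumulantMdpTransfer at time t componentwise, union
bound for the momentum vector. [difficulty: L] [Spohn1991, DoringEichelsbacher2012,
SaulisStatulevicius1991]

TWO-LAYER PLAN. Foreseen glued splits, none filed now. CumulantBounds ⇐ StaticCumulantBounds (t = 0
slice: inhomogeneous-activity cluster expansion of the
canonical hard-sphere pressure with Gaussian velocity marks, Scola2021 / Ruelle1969 Ch. 4 —
provable, L) → MixedCumulantDecay (k ≥ 3, j,l ≥ 1
mixed (X_t, Y_0) cumulants only; pure cumulants are static by HomogeneousInvariance) →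
CumulantBounds (glue: multinomial expansion of
κ_k(uX + bY), k = 2 by Cauchy–Schwarz + stationarity). EulerScaleCovariance ⇐ Response3075 (=
stmt-3075, κ-homotopy form) → StaticsAndUniqueness
(StaticScoreResponse 3074-type differentiability of the LLN profiles + classical uniqueness for the
constant-coefficient symmetric-hyperbolic
linearised system) → EulerScaleCovariance, filed when 3075 or MourreKoopman's OneBodyCompleteness
(4356) moves. A split of CumulantBounds by
TIME REGIME (kinetic times t ≤ cN^(-1/3) vs macroscopic t) has no glue (no semigroup for cumulants)
and is deliberately not planned.
AmplitudeUniformLimit ⇐ MesoscopicMembers (all δ_N → 0 in the admissible range: SoundWindow + PDE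
linearisation + path comparison) →
FixedAmplitudeMembers (δ_N → δ ∈ (0,1]: the conjunct for the δ-member of the power path — every
engine route) → AmplitudeUniformLimit
(glue: a subsequence argument splitting any admissible sequence into its mesoscopic and
non-mesoscopic parts; uniformity is the content).

KILL CRITERIA. (a) ¬ThirdCumulantBound — (N+1)²κ₃ of two-time conserved-field statistics unbounded
in N at a fixed macroscopic t (equilibrium MD can show it) —
refutes CumulantBounds with it for EVERY Gevrey index (the slack concerns k-growth, not N-growth):
close --reason refuted:CumulantBounds, and
the witness is evidence against AmplitudeAnalyticity's 5609/5611 too. (b) ¬CumulantBounds with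
ThirdCumulantBound intact (k-growth worse than
factorial but extensive in N): ONE restatement to Gevrey bounds C^k(k!)^(1+γ) with the target shrunk
to a < 1/(2+4γ) and the transfer replaced
by its Rudzkis–Saulis–Statulevičius / DoringEichelsbacher2012 version; a second refutation closes.
(c) ¬EulerScaleCovariance (a ballistic
non-hydrodynamic channel / positive excess Drude weight at arbitrarily small σ, or a structure
function not of Landau–Placzek form) closes the
route, refutes stmt-3075 (LaceRingBootstrap, OneParticleInfluence) in substance and is strong
evidence against the conjunct near equilibrium —
operator alarm. (d) SoundWindow cannot die with both cruxes alive (Assembly); a direct MD refutation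
of SoundWindow (dispersive/damped mesoscopic
sound at times O(1) beyond o(1)) therefore locates a false crux. Proof of 3075 or of
OneBodyCompleteness+statics elsewhere is CONSUMED (glue to
EulerScaleCovariance filed as support), not mooting; HydrodynamicLimit proved elsewhere closes the
corner but not the ladder (uniformity + windows remain). (e) ¬AmplitudeUniformLimit at
INTERMEDIATE amplitudes with the conjunct and the windows alive (genuine non-uniformity in the
amplitude) ⇒ restate the top to the members
actually climbed (--restate AmplitudeUniformLimit); `closes` survives any restatement that keeps the
corner δ ≡ 1.

NOT DECOMPOSED YET. (i) Layer-2 children of CumulantBounds (static slice provable; kinetic-time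
slice t ≤ cN^(-1/3) open at fixed σ — DiluteRegimeBarrier: not even
one mean free time has a Lanford-type theorem there; macroscopic slice = the crux) — see Two-layer
plan. (ii) The Gevrey (γ > 0) transfer
(window a < 1/(2+4γ): DoringEichelsbacher2012 zone a_n ≪ Δ^(1/(1+2γ)), Δ = √N; the bivariate TILTED
form needs Bentkus–Rudzkis-type Bernstein
inequalities under cumulant conditions) — prose only until kill criterion (b) fires; the filed
transfer is the γ = 0 theorem the Assembly uses.
(iii) --supports lemmas: uniform one-point density of the canonical law on 𝕋³, measurability of
field statistics ∘ flow, cgf = its Taylor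
series on the integrability strip (Mathlib ProbabilityTheory.analyticAt_cgf), polarisation
constants.
(iv) The card's ASSEMBLY HYGIENE LEMMA (exponential-rate HL on a sup-dense profile class ⇒ all
profiles) is NOT filed: the entropy-inequality
transfer bounds P_LG(A) by ≈ ε_η/c′_η (sup-distance of log-profiles over the approximant's
exponential rate), so it needs LOCAL UNIFORMITY of the
rate over C^k-neighbourhoods of the data (plus Kato continuous dependence inside the lifespan) — a
corrected version belongs to the LD-rate routes
(SpacetimeExtensivity, KineticWindows). (v) The card's conditional bridge (β) through
FirstFailureBlowup is unavailable as typed: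
SmallDataHydrodynamics (3332) / ShortTimePropagation (3329) are fixed-amplitude statements; an
N-dependent-amplitude restatement making
SoundWindow(1/2 − b) their input is tenure business for that route. (vi) The edge diagnostic a = 1/2
(tilt θ = √N = Cramér radius: the cumulant
method provably stops; the conjunct is a large-deviation, not a moderate-deviation, statement about
(Φ, G)) is not a statement about spheres —
recorded, not filed. (vii) Definitions IsLinearisedHsEulerSolution / conservedFieldStatistic (see
Definition requests) — inlined for now. (viii) The two lemmas
linking the rung to the ladder's bottom members: PDE linearisation ((U^δ − Ū)/δ → U₁ in C⁰([0,t] ×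
𝕋³) pre-shock, Kato1975 / Majda1984
continuous dependence) and PATH COMPARISON (power path vs exact-tilt path agree to O(δ²) in the
profiles; at mesoscopic δ_N the induced change
of the rescaled fields is O(δ_N) → 0 — via the window WITH RATE e^(-cN^(2a)), which
CumulantMdpTransfer's proof yields, plus relative entropy
N·O(δ_N⁴) ≪ N^(2a)) — layer-2 children of AmplitudeUniformLimit, not filed now.

CHEAPEST FALSIFIER. (i) Equilibrium event-driven MD (kit; NOT run — planners are compute-free here):
hard spheres at packing (π/6)σ³ ≈ 0.05, N = 10³–10⁵:
the mixed third cumulants (N+1)²κ₃(X_t, X_t, Y_0), (N+1)²κ₃(X_t, Y_0, Y_0) for X, Y = n(cos 2πx₁)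
(and longitudinal momentum) at t = 0.25, 0.5, 1
sound-crossing times must stay O(1) (third cumulant of the √N-scaled pair ∝ N^(-1/2)); growth with N
kills ThirdCumulantBound, CumulantBounds and
the route (and wounds AmplitudeAnalyticity). Same run, k = 2: (N+1)Cov_G(Y, X_t) vs the
Landau–Placzek prediction with c² = θe(Z + σ³Z′ + ⅔Z²)
tests EulerScaleCovariance. (ii) Pen and paper, DONE as calibration: IDEAL GAS (free flight, product
measure) — CumulantBounds holds trivially
while EulerScaleCovariance FAILS (ballistic streaming ≠ linearised Euler: IdealGasNoDecay 4359) —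
crux #2 alone proves nothing; the ergodic
content is isolated in #3, as it must be. (iii) Lookup (done, negative): an MDP or N-uniform
two-time cumulant bound for ANY deterministic
interacting gas at positive density — none (stochastic: Gao2003, GaoXia2026; static: Scola2021).

NUMBERS. δ_N = (N+1)^(a-1/2); tilt parameter θ_N = δ_N√(N+1) = (N+1)^a; tilt entropy H(LG_N|G_N) ≍
(N+1)^(2a) → ∞ (out of equilibrium) while δ_N → 0;
MDP speed (N+1)^(2a); transfer error (γ = 0): nδ³/θ² = δ_N → 0; cumulant series radius |ζ| <
(N+1)·min(s₀, 1/2C) versus the tilt ζ = δ_N(N+1):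
inside iff δ_N < min(s₀, 1/2C) — eventually for every a < 1/2, a CONSTRAINT exactly at the edge a =
1/2 (δ = O(1): the conjunct). Gevrey window
a < 1/(2+4γ) (Statulevičius condition |Γ_k| ≤ (k!)^(1+γ)/Δ^(k-2), Δ = √N; DoringEichelsbacher2012).
Limit system: sound speed c² = p_ρ + Z·(2/3)p̄ =
θe(Z + σ³Z′ + ⅔Z²) with Z = hsCompressibility(σ³) = 1 + (2π/3)σ³ + O(σ⁶) (HardSphereEuler.lean;
agrees with BurgersWindow 5861), entropy and
two shear modes standing. MD regime of the card: relative amplitude 0.03 at N = 10⁶ is a ≈ 0.25,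
mid-window. EquilibriumIsProbability threshold: σ < 1/2. Items: 11 (1 target, 4 cruxes, 5 support, 1
assembly) + closes; all elaborate.

DEFINITION REQUESTS. None needed to type the items (localGibbsLaw, empirical fields, hsPressure,
hsCompressibility, Torus calculus, Mathlib cgf / covariance /
Measure.tilted exist). Deferred deliberately (to be filed by tenure once a grounder confirms the
shapes): `IsLinearisedHsEulerSolution σ θe T ρ₁ u₁ θ₁`
(topic Literature/MathematicalPhysics/KineticTheory, next to IsHardSphereEulerSolution; one request
should serve OneParticleInfluence's
LinearizedHsEuler too) and `conservedFieldStatistic ψ₀ ψv ψ₄ z` (the shape n(ψ₀) + Σ_j p(ψv_j)_j +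
e(ψ₄) used by four decls) — both are inlined
now as let-bindings / hypotheses, as SpacetimeExtensivity did with its block fields.

Novelty: Searches (2026-08-15): `lit search --source crossref "moderate deviations via cumulants"` (12:
doi:10.1007/s10959-012-0437-0 = DoringEichelsbacher2012,
doi:10.1007/s10955-021-02740-2 = Scola2021 static Gibbs MDP via cluster expansion,
doi:10.1016/j.jfa.2016.01.002); `… crossref "moderate deviations
hydrodynamic limit"` (12: doi:10.1360/02ys0114 = Gao2003 SSEP, doi:10.1016/s0252-9602(06)60095-7
Wang–Gao Ginzburg–Landau, doi:10.1007/978-3-031-32601-1_7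
Dolgopyat–Sarig); `… crossref "Fluctuations and moderate deviations for a binary collision model"`
(doi:10.1007/s10955-026-03570-w = GaoXia2026,
stochastic; doi:10.1007/s00222-026-01429-1 CLO heat equation); `… crossref "ballistic macroscopic
fluctuation theory …"` (doi:10.21468/scipostphys.15.4.136 =
DoyonEtAl2023, doi:10.1088/1742-5468/adfe57 Kundu hard rods 2025); `lit search --hybrid --source
local "cumulants large deviations Statulevicius
condition Cramer zone"` (10 textbook hits — Borovkov, DasGupta, Čekanavičius — none on particle
systems; SaulisStatulevicius1991 not held);
`lit read book:spohn1991… --grep "(7.1[3-9])"` (pp. 88–89 read: (7.13)–(7.19); (7.16) is the tilt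
identity differentiated at λ = 0); `lit galaxy
search --star all` ×2 ("moderate deviations from the hydrodynamic limit", "moderate deviations for
particle systems": 0 + 0 + 0 hits each);
OpenAlex / Semantic Scholar / arXiv endpoints rate-limited (HTTP 429) this session — the card's owed
OpenAlex sweep was replaced by the crossref
sweeps above; `ledger negat  [refs: 10.1007/s10959-012-0437-0, 10.1007/s10955-021-02740-2, 10.1016/j.jfa.2016.01.002, 10.1360/02ys0114, 10.1016/s0252-9602(06, 10.1007/978-3-031-32601-1_7, 10.1007/s10955-026-03570-w, 10.1007/s00222-026-01429-1, 10.21468/scipostphys.15.4.136, 10.1088/1742-5468/adfe57, doi:10.1007/s10959-012-0437-0, doi:10.1007/s10955-021-02740-2, doi:10.1016/j.jfa.2016.01.002, doi:10.1360/02ys0114, doi:10.1016/s0252-9]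

Barriers (technique_class: moderate-deviations cumulant-method gibbs-tilt): - technique_class: moderate-deviations cumulant-method gibbs-tilt
- Literature.Barriers.AtomisticToContinuum.BoltzmannHypothesisBarrier: no classification of
invariant states of the infinite dynamics is invoked; the only stationary law is the finite-N
canonical Gibbs law, exactly tilted. The barrier's ideal-gas kernel is respected and LOCATED: for
free flight CumulantBounds holds trivially while EulerScaleCovariance is false (ballistic streaming
≠ linearised Euler; IdealGasNoDecay 4359), so all ergodic content sits in crux #3 at the linear
two-point level — the weakest form in which the barrier can appear — and in the k ≥ 3 mixed bounds
of #2; a hidden sixth one-body charge would refute #3 through Mazur's inequality (proved in the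
FouriersLaw-side catalogue file MazurBoundBallistic.lean, Mazur1969_inequality) — kill criterion
(c); the bet is that bounds are provable by expansion where classification is not.
- Literature.Barriers.AtomisticToContinuum.BoltzmannHypothesisBarrierNarrow: no flux-level one-block
replacement; currents never appear (conserved fields only, exact tilt, stationarity).
- Literature.Barriers.AtomisticToContinuum.HighMomentumCutoffBarrier: not met at the level of
statements — linear statistics of (1, v, |v|²/2) under the INVARIANT Gibbs law have Gaussian
velocity tails at every time; uniform exponential moments are the static clause (i) of
CumulantBounds; nothing is ever estimated under the non-equilibrium law LG_N directly (the tilt is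
exact), and the cub

History (route lifecycle, newest last):
- 2026-08-15T16:33:59Z · rev 2: restated AmplitudeUniformLimit (stmt-AtomisticToContinuum-9614) — @note.txt (planner-rrepair-AtomisticToContinuum-CramerEdg-a978dc15-g2-0)
- 2026-08-16T03:15:00Z · CLOSED retired — not-a-thesis: target-unreachable — no item concludes the target AmplitudeUniformLimit and no honest glue exists: the moderate-deviation engine reaches only the δ_N→0 members; any Crux…→top chain needs (planner-rchoice-AtomisticToContinuum-CramerEdg-c7e622b8-0)

sub-problem: HydrodynamicLimit · status: closed(retired) · opened planner-plancard-AtomisticToContinuum-Hydrody-eecd15a5-0 2026-08-15T14:05:07Z · rev 3 · ledger route-AtomisticToContinuum-CramerEdgeLadder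
GENERATED by the gate from the ledger (D-0016/17). Provers cite these decls: `theorem foo : Summit.AtomisticToContinuum.HydrodynamicLimit.Theses.CramerEdgeLadder.<Decl> := …` in Summits/AtomisticToContinuum/HydrodynamicLimit/Theorems/<Name>.lean.
-/

namespace Summit.AtomisticToContinuum.HydrodynamicLimit.Theses.CramerEdgeLadder

open scoped BigOperators Topology Manifold Classical MeasureTheory ProbabilityTheory Matrix InnerProductSpace ComplexConjugate ContinuousMap
open Filter Set Function TopologicalSpace MeasureTheory

attribute [summit_statement] _root_.HydrodynamicLimit

-- earlier AmplitudeUniformLimit (stmt-AtomisticToContinuum-9614, replaced 2026-08-15T16:33:59Z -> stmt-AtomisticToContinuum-10964): retired by None — open Literature.MathematicalPhysics.KineticTheory Literature.Analysis.FluidPDE MeasureTheory Filter Topology in ∀ (a₀ θ₀ : T3 → ℝ) (u₀ : T3 → V3), Continuous a₀ → Continuous θ₀ → Continuous u₀ → (∀ x, 0 < a₀ x) → (∀ x, 0 < θ₀ x) → ∀ θe : ℝ, 0 < θe → ∀ 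
/-- item stmt-AtomisticToContinuum-10964 · target · rank 0 · closed · moot by None · by planner
why it might fail: Contains the conjunct (corner δ≡1) and every mesoscopic window; beyond both it asserts UNIFORMITY in the amplitude with relative precision ηδ_N — an intermediate-amplitude slow mode or an amplitude-dependent loss of precision refutes it even if each fixed-δ limit holds.
sources: Spohn1991, OllaVaradhanYau1993, DoringEichelsbacher2012, DoyonEtAl2023, Kato1975
[target] LADDER TOP, PINNED (2026-08-15 repair of the retriage signature concern) — the hydrodynamic
limit uniform in the data amplitude: power-path local Gibbs data (a₀^δ_N, δ_N u₀, θe^(1-δ_N)θ₀^δ_N),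
any admissible amplitude sequence (N+1)^(a-1/2) ≤ δ_N ≤ 1, a d-indexed family of classical hs-Euler
solutions on [0,T) whose every USED member d = δ_N is PINNED to the amplitude-δ_N local Gibbs data
conjunct-style (TendstoHydroFieldsAt at t = 0 along the full sequence M → ∞, fixed precision — so it
IS the Euler solution issued from the amplitude-δ_N hydrodynamic profile, unique by the proved
localGibbs_lln + continuity; this removes the free choice of N-dependent stratified members that
passed the weak o(δ_N) matching), amplitude-relative matching at t = 0 ⇒ amplitude-relative
convergence in probability at every t < T. Corner δ_N ≡ 1 with the constant family = the conjunct
(the pin is literally its hypothesis h0; theorem closes); bottom members = the sound windows (crux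
SoundWindow, up to the PDE-linearisation and path-comparison lemmas of § Not decomposed yet).
[difficulty: open-problem] -/
@[route_item "route-AtomisticToContinuum-CramerEdgeLadder"]
def AmplitudeUniformLimit : Prop :=
  open Literature.MathematicalPhysics.KineticTheory Literature.Analysis.FluidPDE MeasureTheory Filter Topology in ∀ (a₀ θ₀ : T3 → ℝ) (u₀ : T3 → V3), Continuous a₀ → Continuous θ₀ → Continuous u₀ → (∀ x, 0 < a₀ x) → (∀ x, 0 < θ₀ x) → ∀ θe : ℝ, 0 < θe → ∀ a : ℝ, 0 < a → a < 1 / 2 → ∃ σ₀ : ℝ, 0 < σ₀ ∧ ∀ σ : ℝ, 0 < σ → σ < σ₀ → ∀ (T : ℝ) (ρE θE : ℝ → ℝ → T3 → ℝ) (uE : ℝ → ℝ → T3 → V3), (∀ d ∈ Set.Ioc (0 : ℝ) 1, IsHardSphereEulerSolution σ T (ρE d) (uE d) (θE d)) → ∀ Φ : (N : ℕ) → HardSphereFlow (Torus.geometry (Fin 3)) (hsDiameter σ N) (N + 1), ∀ δ : ℕ → ℝ, (∀ N : ℕ, ((N : ℝ) + 1) ^ (a - 1 / 2) ≤ δ N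 ∧ δ N ≤ 1) → (∀ N : ℕ, TendstoHydroFieldsAt (fun M => localGibbsLaw σ (fun x => a₀ x ^ δ N) (fun x => δ N • u₀ x) (fun x => θe ^ (1 - δ N) * θ₀ x ^ δ N) M (Φ M)) Φ (ρE (δ N)) (uE (δ N)) (θE (δ N)) 0) → let P : (N : ℕ) → Measure (Config (N + 1) (Fin 3) T3) := fun N => localGibbsLaw σ (fun x => a₀ x ^ δ N) (fun x => δ N • u₀ x) (fun x => θe ^ (1 - δ N) * θ₀ x ^ δ N) N (Φ N); let R : ℝ → Prop := fun t => ∀ χ : T3 → ℝ, Continuous χ → ∀ η : ℝ, 0 < η → Tendsto (fun N => P N {z | η * δ N < |empiricalDensityField ((Φ N).flow t z) χ - ∫ x, χ x * ρE (δ N) t x|}) atTop (𝓝 0) ∧ Tendsto (fun N => P N {z | η * δ N < ‖empiricalMomentumField ((Φ N).flow t z) χ - ∫ x, (χ x * ρE (δ N) t x) • uE (δ N) t x‖}) atTop (𝓝 0) ∧ Tendsto (fun N => P N {z | η * δ N < |empiricalEnergyField ((Φ N).flow t z) χ - ∫ x, χ x * totalEnergyDensity (ρE (δ N) t x) (uE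 (δ N) t x) (θE (δ N) t x)|}) atTop (𝓝 0); R 0 → ∀ t ∈ Set.Ico 0 T, R t

/-- item stmt-AtomisticToContinuum-9615 · crux · rank 2 · open · by planner
why it might fail: Needs an N-uniform analyticity radius at 0 of the finite-N joint cgf of (X_t,Y_0) at fixed σ over ≍N^(1/3) mean free times: mixed cumulants may grow super-factorially in k (only Gevrey: kill (b)) or super-extensively in N via recollision/ring (long-time-tail) correlations; proved for no such gas.
sources: Spohn1991, SaulisStatulevicius1991, DoringEichelsbacher2012, Scola2021, PulvirentiTsagkarogiannis2012, ErnstHaugeVanleeuwen1970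
[crux] (card crux 1, analytic type γ = 0) ANALYTIC-TYPE EQUILIBRIUM SPACE-TIME CUMULANT BOUNDS: for
θe > 0 and continuous directions (α, w, τ) there is σ₀ such that for σ < σ₀, all flows, t ≥ 0 and
continuous test functions (χ₀, χv, χ₄): with G_N the canonical law localGibbsLaw σ 1 0 θe, X =
[n(χ₀) + p(χv) + e(χ₄)]∘Φ_t the conserved-type linear field statistic at time t and Y = n(α) +
p(w/θe) + e(τ/θe) the tilt statistic at time 0, there are C, s₀ > 0 with (i) E_G exp(s(N+1)(uX +
bY)) < ∞ for |s| ≤ s₀, |u|,|b| ≤ 1 (uniform exponential moments — statics) and (ii) |κ_k^G(uX +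
bY)|·(N+1)^(k-1) ≤ C^k k! for all k ≥ 2, N, |u|,|b| ≤ 1 (κ_k = k-th derivative at 0 of the Mathlib
cgf). Pure (single-time) cumulants are static by invariance; the content is the N^(1-k) decay of
MIXED two-time cumulants, i.e. an N-uniform real-analyticity radius of the finite-N LD pressure of
(X_t, Y_0) at the origin. [difficulty: open-problem] -/
@[route_item "route-AtomisticToContinuum-CramerEdgeLadder"]
def CumulantBounds : Prop :=
  open Literature.MathematicalPhysics.KineticTheory Literature.Analysis.FluidPDE MeasureTheory ProbabilityTheory in ∀ θe : ℝ, 0 < θe → ∀ (α τ : T3 → ℝ) (w : T3 → V3), Continuous α → Continuous τ → Continuous w → ∃ σ₀ : ℝ, 0 < σ₀ ∧ ∀ σ : ℝ, 0 < σ → σ < σ₀ → ∀ Φ : (N : ℕ) → HardSphereFlow (Torus.geometry (Fin 3)) (hsDiameter σ N) (N + 1), ∀ t : ℝ, 0 ≤ t → ∀ (χ₀ χ₄ : T3 → ℝ) (χv : T3 → V3), Continuous χ₀ → Continuous χ₄ → Continuous χv → let G : (N : ℕ) → Measure (Config (N + 1) (Fin 3) T3) := fun N => localGibbsLaw σ (fun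 _ => 1) (fun _ => 0) (fun _ => θe) N (Φ N); let L : (T3 → ℝ) → (T3 → V3) → (T3 → ℝ) → (N : ℕ) → Config (N + 1) (Fin 3) T3 → ℝ := fun ψ₀ ψv ψ₄ _ z => empiricalDensityField z ψ₀ + (∑ j, empiricalMomentumField z (fun x => ψv x j) j) + empiricalEnergyField z ψ₄; let X : (N : ℕ) → Config (N + 1) (Fin 3) T3 → ℝ := fun N z => L χ₀ χv χ₄ N ((Φ N).flow t z); let Y : (N : ℕ) → Config (N + 1) (Fin 3) T3 → ℝ := fun N z => L α (fun x => θe⁻¹ • w x) (fun x => θe⁻¹ * τ x) N z; ∃ C s₀ : ℝ, 0 < s₀ ∧ (∀ u b : ℝ, |u| ≤ 1 → |b| ≤ 1 → ∀ N : ℕ, ∀ s : ℝ, |s| ≤ s₀ → Integrable (fun z => Real.exp (s * ((N : ℝ) + 1) * (u * X N z + b * Y N z))) (G N)) ∧ (∀ u b : ℝ, |u| ≤ 1 → |b| ≤ 1 → ∀ N k : ℕ, 2 ≤ k → |iteratedDeriv k (cgf (fun z => u * X N z + b * Y N z) (G N)) 0| * ((N : ℝ) + 1) ^ (k - 1) ≤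 C ^ k * (k.factorial : ℝ))

/-- item stmt-AtomisticToContinuum-9616 · crux · rank 3 · closed · moot by None · by planner
why it might fail: It is Spohn's conjecture (7.13)/(7.18) [Spohn1991 pp. 88-89], open at positive density for every deterministic model but hard rods: a sixth quasi-conserved one-body quantity (excess Drude weight > 0, Mazur bound) or a non-Landau-Placzek structure at small σ>0 falsifies linearised-Euler transport.
sources: Spohn1991, Doyon2022, BoldrighiniDobrushinSukhov1983, BoldrighiniWick1988, Mazur1969, DoyonEtAl2023
[crux] (card crux 2 = Spohn's Euler-scale two-point conjecture (7.18)–(7.19), LINEAR MATCHED FORM)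
for θe > 0 and continuous directions (α, w, τ) there is σ₀ such that for σ < σ₀, every classical
solution (ρ₁, u₁, θ₁) on [0,T) of the linearised hs-Euler system about (1, 0, θe) and all flows: IF
the static covariances match the data, (N+1)·Cov_G(Y, n_0(χ)) → ∫χρ₁(0), (N+1)·Cov_G(Y, p_0(χ)_j) →
∫χu₁,ⱼ(0), (N+1)·Cov_G(Y, e_0(χ)) → ∫χ·(3/2)(θeρ₁ + θ₁)(0) for all continuous χ, THEN the same holds
at every t ∈ [0,T) with the time-t fields ∘Φ_t: Euler-scale equilibrium time correlations of the
conserved fields of hard spheres at fixed σ are transported by linearised Euler (two sound modes at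
the dense sound speed, standing entropy/shear modes). Same content as EquilibriumLinearResponse
(stmt-3075, κ-homotopy response form) restricted to the base point and freed of the nonlinear Euler
family; the zero-excess-Drude-weight input is MourreKoopman's OneBodyCompleteness (4356).
[difficulty: open-problem] -/
@[route_item "route-AtomisticToContinuum-CramerEdgeLadder"]
def EulerScaleCovariance : Prop :=
  open Literature.MathematicalPhysics.KineticTheory Literature.Analysis.FluidPDE Literature.Analysis.FunctionSpaces MeasureTheory ProbabilityTheory Filter Topology in ∀ θe : ℝ, 0 < θe → ∀ (α τ : T3 → ℝ) (w : T3 → V3), Continuous α → Continuous τ → Continuous w → ∃ σ₀ : ℝ, 0 < σ₀ ∧ ∀ σ : ℝ, 0 < σ → σ < σ₀ → ∀ (T : ℝ) (ρ₁ θ₁ : ℝ → T3 → ℝ) (u₁ : ℝ → T3 → V3), Torus.IsSmoothSpaceTimeOn (Ico 0 T) ρ₁ → Torus.IsSmoothSpaceTimeOn (Ico 0 T) u₁ → Torus.IsSmoothSpaceTimeOn (Ico 0 T) θ₁ → (∀ t ∈ Ico 0 T, ∀ x, Torus.timeDerivWithin (Ico 0 T) ρ₁ t x + Torus.divergence (u₁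 t) x = 0 ∧ Torus.timeDerivWithin (Ico 0 T) u₁ t x + deriv (fun r => hsPressure σ r θe) 1 • Torus.gradient (ρ₁ t) x + hsCompressibility (σ ^ 3) • Torus.gradient (θ₁ t) x = 0 ∧ Torus.timeDerivWithin (Ico 0 T) θ₁ t x + 2 / 3 * hsPressure σ 1 θe * Torus.divergence (u₁ t) x = 0) → ∀ Φ : (N : ℕ) → HardSphereFlow (Torus.geometry (Fin 3)) (hsDiameter σ N) (N + 1), let G : (N : ℕ) → Measure (Config (N + 1) (Fin 3) T3) := fun N => localGibbsLaw σ (fun _ => 1) (fun _ => 0) (fun _ => θe) N (Φ N); let Y : (N : ℕ) → Config (N + 1) (Fin 3) T3 → ℝ := fun _ z => empiricalDensityField z α + (∑ j, empiricalMomentumField z (fun x => θe⁻¹ * w x j) j) + empiricalEnergyField z (fun x => θe⁻¹ * τ x); let R : ℝ → Prop := fun t => ∀ χ : T3 → ℝ, Continuous χ → Tendsto (fun N : ℕ => ((N : ℝ) + 1) * covariance (Y N) (fun z => empiricalDensityField ((Φ N).flow t z) χ) (G N)) atTop (𝓝 (∫ x, χ x * ρ₁ t x)) ∧ (∀ j :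 Fin 3, Tendsto (fun N : ℕ => ((N : ℝ) + 1) * covariance (Y N) (fun z => empiricalMomentumField ((Φ N).flow t z) χ j) (G N)) atTop (𝓝 (∫ x, χ x * u₁ t x j))) ∧ Tendsto (fun N : ℕ => ((N : ℝ) + 1) * covariance (Y N) (fun z => empiricalEnergyField ((Φ N).flow t z) χ) (G N)) atTop (𝓝 (∫ x, χ x * (3 / 2 * (θe * ρ₁ t x + θ₁ t x)))); R 0 → ∀ t ∈ Ico 0 T, R t

/-- item stmt-AtomisticToContinuum-9617 · crux · rank 4 · closed · moot by None · by planner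
why it might fail: Dies with either crux (#2 super-CLT mixed cumulants, #3 non-Euler two-point transport): the mesoscopic δ_N=N^(a-1/2) response of deterministic spheres at times O(1) could be nonlinear or dispersive via a slow non-hydrodynamic mode; MDPs from hydrodynamics are known only for stochastic dynamics.
sources: Spohn1991, Gao2003, GaoXia2026, DoringEichelsbacher2012, SaulisStatulevicius1991, DoyonEtAl2023
[crux] THE FIRST RUNG (card: ModerateAmplitudeHL(a), all a ∈ (0, 1/2)): for θe > 0, continuous
directions (α, w, τ) and σ < σ₀, under the exact-tilt-path local Gibbs laws at amplitude δ_N =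
(N+1)^(a-1/2) the RESCALED fields ([n_t(χ) − ∫χ], p_t(χ), [e_t(χ) − (3θe/2)∫χ])/δ_N converge in
probability at every t < T to (ρ₁, u₁, (3/2)(θeρ₁ + θ₁))(t) for every classical linearised hs-Euler
solution matched at t = 0 (conjunct-style). Derived inside the route by WindowAssembly from cruxes
#2, #3 and the provable supports; claimable directly; the MD-falsifiable member of the ladder.
[deps: CumulantBounds, EulerScaleCovariance] [difficulty: open-problem] -/
@[route_item "route-AtomisticToContinuum-CramerEdgeLadder"]
def SoundWindow : Prop :=
  open Literature.MathematicalPhysics.KineticTheory Literature.Analysis.FluidPDE Literature.Analysis.FunctionSpaces MeasureTheory Filter Topology in ∀ a : ℝ, 0 < a → a < 1 / 2 → ∀ θe : ℝ, 0 < θe → ∀ (α τ : T3 → ℝ) (w : T3 → V3), Continuous α → Continuous τ → Continuous w → ∃ σ₀ : ℝ, 0 < σ₀ ∧ ∀ σ : ℝ, 0 < σ → σ < σ₀ → ∀ (T : ℝ) (ρ₁ θ₁ : ℝ → T3 → ℝ) (u₁ : ℝ → T3 → V3), Torus.IsSmoothSpaceTimeOn (Ico 0 T) ρ₁ → Torus.IsSmoothSpaceTimeOn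 (Ico 0 T) u₁ → Torus.IsSmoothSpaceTimeOn (Ico 0 T) θ₁ → (∀ t ∈ Ico 0 T, ∀ x, Torus.timeDerivWithin (Ico 0 T) ρ₁ t x + Torus.divergence (u₁ t) x = 0 ∧ Torus.timeDerivWithin (Ico 0 T) u₁ t x + deriv (fun r => hsPressure σ r θe) 1 • Torus.gradient (ρ₁ t) x + hsCompressibility (σ ^ 3) • Torus.gradient (θ₁ t) x = 0 ∧ Torus.timeDerivWithin (Ico 0 T) θ₁ t x + 2 / 3 * hsPressure σ 1 θe * Torus.divergence (u₁ t) x = 0) → ∀ Φ : (N : ℕ) → HardSphereFlow (Torus.geometry (Fin 3)) (hsDiameter σ N) (N + 1), let δ : ℕ → ℝ := fun N => ((N : ℝ) + 1) ^ (a - 1 / 2); let P : (N : ℕ) → Measure (Config (N + 1) (Fin 3) T3) := fun N => localGibbsLaw σ (fun x => Real.exp (δ N * α x + δ N ^ 2 * ‖w x‖ ^ 2 / (2 * θe * (1 - δ N * τ x))) * (1 - δ N * τ x) ^ (-(3 / 2 : ℝ))) (fun x => (δ N / (1 - δ N * τ x)) • w x) (fun x => θe / (1 - δ N * τ x)) N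 (Φ N); let R : ℝ → Prop := fun t => ∀ χ : T3 → ℝ, Continuous χ → ∀ η : ℝ, 0 < η → Tendsto (fun N => P N {z | η < |(empiricalDensityField ((Φ N).flow t z) χ - ∫ x, χ x) / δ N - ∫ x, χ x * ρ₁ t x|}) atTop (𝓝 0) ∧ Tendsto (fun N => P N {z | η < ‖(δ N)⁻¹ • empiricalMomentumField ((Φ N).flow t z) χ - ∫ x, χ x • u₁ t x‖}) atTop (𝓝 0) ∧ Tendsto (fun N => P N {z | η < |(empiricalEnergyField ((Φ N).flow t z) χ - 3 / 2 * θe * ∫ x, χ x) / δ N - ∫ x, χ x * (3 / 2 * (θe * ρ₁ t x + θ₁ t x))|}) atTop (𝓝 0); R 0 → ∀ t ∈ Ico 0 T, R t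

/-- item stmt-AtomisticToContinuum-9618 · crux · rank 5 · closed · moot by None · by planner
why it might fail: k=3 slice, cheapest falsifier: sup_N (N+1)²|κ₃| of two-time conserved-field statistics at macroscopic t is predicted finite only by non-rigorous BMFT; t^(-3/2) current tails, sound-cone caustics or dynamically emerging long-range correlations could make 3-point space-time cumulants super-extensive.
sources: DoyonEtAl2023, DoyonEtAl2023PRL, AlderWainwright1970, ErnstHaugeVanleeuwen1970, Spohn1991, BGSSCPAM2023
[crux] (the k = 3 special case of CumulantBounds, filed as the MD-checkable and first provable
dynamical foothold; CumulantBounds ⇒ ThirdCumulantBound) same frame: uniform exponential moments and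
sup_N (N+1)²·|κ₃^G(uX + bY)| ≤ C for |u|,|b| ≤ 1 — the two-time third cumulants (X_t, X_t, Y_0),
(X_t, Y_0, Y_0) of conserved-field statistics are extensive, i.e. the CLT-normalised third cumulant
decays like (N+1)^(-1/2), uniformly at macroscopic t. [difficulty: open-problem] -/
@[route_item "route-AtomisticToContinuum-CramerEdgeLadder"]
def ThirdCumulantBound : Prop :=
  open Literature.MathematicalPhysics.KineticTheory Literature.Analysis.FluidPDE MeasureTheory ProbabilityTheory in ∀ θe : ℝ, 0 < θe → ∀ (α τ : T3 → ℝ) (w : T3 → V3), Continuous α → Continuous τ → Continuous w → ∃ σ₀ : ℝ, 0 < σ₀ ∧ ∀ σ : ℝ, 0 < σ → σ < σ₀ → ∀ Φ : (N : ℕ) → HardSphereFlow (Torus.geometry (Fin 3)) (hsDiameter σ N) (N + 1), ∀ t : ℝ, 0 ≤ t → ∀ (χ₀ χ₄ : T3 → ℝ) (χv : T3 → V3), Continuous χ₀ → Continuous χ₄ → Continuous χv → let G : (N : ℕ) → Measure (Config (N + 1) (Fin 3) T3) := fun N => localGibbsLaw σ (fun _ => 1) (fun _ => 0) (fun _ =>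 θe) N (Φ N); let L : (T3 → ℝ) → (T3 → V3) → (T3 → ℝ) → (N : ℕ) → Config (N + 1) (Fin 3) T3 → ℝ := fun ψ₀ ψv ψ₄ _ z => empiricalDensityField z ψ₀ + (∑ j, empiricalMomentumField z (fun x => ψv x j) j) + empiricalEnergyField z ψ₄; let X : (N : ℕ) → Config (N + 1) (Fin 3) T3 → ℝ := fun N z => L χ₀ χv χ₄ N ((Φ N).flow t z); let Y : (N : ℕ) → Config (N + 1) (Fin 3) T3 → ℝ := fun N z => L α (fun x => θe⁻¹ • w x) (fun x => θe⁻¹ * τ x) N z; ∃ C s₀ : ℝ, 0 < s₀ ∧ (∀ u b : ℝ, |u| ≤ 1 → |b| ≤ 1 → ∀ N : ℕ, ∀ s : ℝ, |s| ≤ s₀ → Integrable (fun z => Real.exp (s * ((N : ℝ) + 1) * (u * X N z + b * Y N z))) (G N)) ∧ (∀ u b : ℝ, |u| ≤ 1 → |b| ≤ 1 → ∀ N : ℕ, |iteratedDeriv 3 (cgf (fun z => u * X N z + b * Y N z) (G N)) 0| * ((N : ℝ) + 1) ^ 2 ≤ C)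

/-- item stmt-AtomisticToContinuum-9619 · support · rank 9 · closed · moot by None · by planner
sources: DoringEichelsbacher2012, SaulisStatulevicius1991, Gao2003
[support] ABSTRACT MODERATE-DEVIATION TRANSFER (card crux 3, γ = 0; pure probability, no spheres):
for a ∈ (0, 1/2), probability spaces (Ω_j, μ_j), sizes n_j ≥ 1 → ∞ and measurable X_j, Y_j with
uniform exponential moments E exp(s n_j(uX_j + bY_j)) < ∞ (|s| ≤ s₀, |u|,|b| ≤ 1), analytic-type
cumulant bounds |κ_k(uX_j + bY_j)| n_j^(k-1) ≤ C^k k! (k ≥ 2) and n_j Cov(X_j, Y_j) → c: under the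
tilted laws μ_j.tilted(n_j^(a+1/2) Y_j) (= exp(δ_j n_j Y_j)dμ_j normalised, δ_j = n_j^(a-1/2)),
n_j^(1/2-a)(X_j − E_μj X_j) → c in probability. Proof (verified): the tilted cgf of λδn(X − EX) is
the convergent series Σ_(k≥2)[κ_k(λX+Y) − κ_k(Y)](nδ)^k/k! inside the radius n·min(s₀, 1/2C)
(analyticAt_cgf); k = 2 term (nδ)²[λ²VarX/2 + λCov], tail ≤ 4n(Cδ)³ = o(n^(2a)); exponential
Chebyshev. [difficulty: provable-now] -/
@[route_item "route-AtomisticToContinuum-CramerEdgeLadder"]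
def CumulantMdpTransfer : Prop :=
  open MeasureTheory ProbabilityTheory Filter Topology in ∀ a : ℝ, 0 < a → a < 1 / 2 → ∀ (Ω : ℕ → Type) [∀ j, MeasurableSpace (Ω j)] (μ : (j : ℕ) → Measure (Ω j)), (∀ j, IsProbabilityMeasure (μ j)) → ∀ n : ℕ → ℝ, (∀ j, 1 ≤ n j) → Tendsto n atTop atTop → ∀ (X Y : (j : ℕ) → Ω j → ℝ), (∀ j, Measurable (X j)) → (∀ j, Measurable (Y j)) → ∀ (C s₀ c : ℝ), 0 < s₀ → (∀ u b : ℝ, |u| ≤ 1 → |b| ≤ 1 → ∀ j : ℕ, ∀ s : ℝ, |s| ≤ s₀ → Integrable (fun ω => Real.exp (s * n j * (u * X j ω + b * Y j ω))) (μ j)) → (∀ u b : ℝ, |u| ≤ 1 → |b| ≤ 1 → ∀ j k : ℕ, 2 ≤ k → |iteratedDeriv k (cgf (fun ω => u * X j ω + b * Y j ω) (μ j)) 0| * (n j) ^ (k - 1) ≤ C ^ k * (k.factorial : ℝ)) → Tendsto (fun j => n j * covariance (X j) (Y j) (μ j)) atTop (𝓝 c) → ∀ ε : ℝ, 0 < ε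 → Tendsto (fun j => ((μ j).tilted (fun ω => (n j) ^ (a + 1 / 2) * Y j ω)) {ω | ε < |(n j) ^ (1 / 2 - a) * (X j ω - ∫ ω', X j ω' ∂(μ j)) - c|}) atTop (𝓝 0)

/-- item stmt-AtomisticToContinuum-9620 · support · rank 9 · open · by planner
sources: Spohn1991, GST2013
[support] THE EXACT TILT (Spohn1991 (7.16) at finite N): for d·τ < 1 pointwise and G_N =
localGibbsLaw σ 1 0 θe N Φ a probability measure, localGibbsLaw σ a_d u_d θ_d N Φ with a_d = exp(dα
+ d²|w|²/(2θe(1-dτ)))·(1-dτ)^(-3/2), u_d = (d/(1-dτ))w, θ_d = θe/(1-dτ) EQUALS G_N.tilted(d(N+1)Y),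
Y = n(α) + Σ_j p(w_j/θe)_j + e(τ/θe): localGibbsProfile_d = localGibbsProfile(1,0,θe)·exp(d(α +
w·v/θe + τ|v|²/(2θe))) pointwise (checked by hand), canonicalDensity normalises, Measure.tilted
divides by Z_d/Z_0. Certifies that the rung's data ARE the conjunct's local Gibbs states.
[difficulty: provable-now] -/
@[route_item "route-AtomisticToContinuum-CramerEdgeLadder"]
def TiltIdentity : Prop :=
  open Literature.MathematicalPhysics.KineticTheory Literature.Analysis.FluidPDE MeasureTheory in ∀ (σ θe d : ℝ), 0 < θe → ∀ (α τ : T3 → ℝ) (w : T3 → V3), Continuous α → Continuous τ → Continuous w → (∀ x, d * τ x < 1) → ∀ (N : ℕ) (Φ : HardSphereFlow (Torus.geometry (Fin 3)) (hsDiameter σ N) (N + 1)), IsProbabilityMeasure (localGibbsLaw σ (fun _ => 1) (fun _ => 0) (fun _ => θe) N Φ) → localGibbsLaw σ (fun x => Real.exp (d * α x + d ^ 2 * ‖w x‖ ^ 2 / (2 * θe * (1 - d * τ x))) * (1 - d * τ x) ^ (-(3 / 2 : ℝ))) (fun x => (d / (1 - d * τ x)) • w x) (fun x => θe / (1 - d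 * τ x)) N Φ = (localGibbsLaw σ (fun _ => 1) (fun _ => 0) (fun _ => θe) N Φ).tilted (fun z => d * ((N : ℝ) + 1) * (empiricalDensityField z α + (∑ j, empiricalMomentumField z (fun x => θe⁻¹ * w x j) j) + empiricalEnergyField z (fun x => θe⁻¹ * τ x)))

/-- item stmt-AtomisticToContinuum-9621 · support · rank 9 · closed · proved by Summit.AtomisticToContinuum.HydrodynamicLimit.Theorems.homogeneousInvariance_proof @ 733069bd6ec4 (prover) · by planner
sources: GST2013, CIP1994, Alexander1975
[support] (= stmt-AtomisticToContinuum-3073 verbatim, shared with OneParticleInfluence /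
HomoenergeticRung) the canonical law with constant profiles is invariant under every hard-sphere
flow, lawAt Φ p t = p (Liouville preservation + energy and momentum conservation on the good set;
rests on PROVED cone facts). Gives E_G[X_t] = E_G[X_0] = the equilibrium values subtracted in
SoundWindow. [difficulty: provable-now] -/
@[route_item "route-AtomisticToContinuum-CramerEdgeLadder"]
def HomogeneousInvariance : Prop :=
  ∀ (σ c θc : ℝ) (uc : Literature.MathematicalPhysics.KineticTheory.V3), 0 < σ → 0 < c → 0 < θc → ∀ (N : ℕ) (Φ : Literature.Analysis.FluidPDE.HardSphereFlow (Literature.Analysis.FluidPDE.Torus.geometry (Fin 3)) (Literature.MathematicalPhysics.KineticTheory.hsDiameter σ N) (N + 1)) (t : ℝ), Φ.lawAt (Literature.MathematicalPhysics.KineticTheory.localGibbsLaw σ (fun _ => c) (fun _ => uc) (fun _ => θc) N Φ) t = Literature.MathematicalPhysics.KineticTheory.localGibbsLaw σ (fun _ => c) (fun _ => uc) (fun _ => θc) N Φ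

/-- `HomogeneousInvariance` holds: proved by `Summit.AtomisticToContinuum.HydrodynamicLimit.Theorems.homogeneousInvariance_proof` @ 733069bd6ec4. -/
theorem HomogeneousInvariance_holds : HomogeneousInvariance := _root_.Summit.AtomisticToContinuum.HydrodynamicLimit.Theorems.homogeneousInvariance_proof

/-- item stmt-AtomisticToContinuum-9622 · support · rank 9 · closed · moot by None · by planner
sources: Alexander1975, Ruelle1969
[support] for 0 < σ < 1/2, θe > 0, every N and flow, localGibbsLaw σ 1 0 θe N Φ is a probability
measure: the partition function is positive (the closed hard-sphere domain contains a neighbourhood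
of the cubic-lattice configuration of spacing 1/⌈(N+1)^(1/3)⌉ > σ(N+1)^(-1/3) for σ < 1/2, times all
velocities) and finite (Gaussian velocities). The probability hypothesis of CumulantMdpTransfer /
TiltIdentity. [difficulty: provable-now] -/
@[route_item "route-AtomisticToContinuum-CramerEdgeLadder"]
def EquilibriumIsProbability : Prop :=
  open Literature.MathematicalPhysics.KineticTheory Literature.Analysis.FluidPDE MeasureTheory in ∀ (σ θe : ℝ), 0 < σ → σ < 1 / 2 → 0 < θe → ∀ (N : ℕ) (Φ : HardSphereFlow (Torus.geometry (Fin 3)) (hsDiameter σ N) (N + 1)), IsProbabilityMeasure (localGibbsLaw σ (fun _ => 1) (fun _ => 0) (fun _ => θe) N Φ)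

/-- item stmt-AtomisticToContinuum-9623 · support · rank 9 · closed · moot by None · by planner
sources: Spohn1991, DoringEichelsbacher2012, SaulisStatulevicius1991
[support] THE RUNG'S GLUE (the closed route's Assembly, verified on paper): σ₀ := min of the σ₀'s
and 1/2; TiltIdentity + EquilibriumIsProbability identify the data law with the tilted canonical
law; HomogeneousInvariance gives E_G X_t = equilibrium values; static matching by
CumulantMdpTransfer at t = 0 along subsequences + uniqueness of limits in probability;
EulerScaleCovariance transports the covariances; CumulantMdpTransfer at time t componentwise, union
bound for the momentum vector. [difficulty: L] -/
@[route_item "route-AtomisticToContinuum-CramerEdgeLadder"]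
def WindowAssembly : Prop :=
  CumulantBounds → EulerScaleCovariance → CumulantMdpTransfer → TiltIdentity → HomogeneousInvariance → EquilibriumIsProbability → SoundWindow

/-- item stmt-AtomisticToContinuum-9624 · assembly · rank 1 · closed · moot by None · by planner
sources: Spohn1991, OllaVaradhanYau1993
[assembly] AmplitudeUniformLimit → HydrodynamicLimit (the corner δ ≡ 1 of the ladder top; proved
outright by `closes`). -/
@[route_item "route-AtomisticToContinuum-CramerEdgeLadder"]
def Assembly : Prop :=
  AmplitudeUniformLimit → HydrodynamicLimit

end Summit.AtomisticToContinuum.HydrodynamicLimit.Theses.CramerEdgeLadder
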